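import Summits.ResolutionOfSingularities.ResolutionOfSingularities.Theorems.EquisingularLiftEquisingularLiftNatNDModelStepChart
import Summits.ResolutionOfSingularities.ResolutionOfSingularities.Theorems.EquisingularLiftEquisingularLiftNatNDModelStepFrame
import HarnessLib

/-!
# [OURS · L1 W4.5(b) · EL♮(3) · ND-K5 (B4α1s)] `ND.modelStep`: ONE TORIC STAR at scheme level

THE ND-K5 BRICK (B4α1s) of res-L1-w45b-idea-1's spec (v12 §13.14, port ✓ p643982 `…NatNDRoundModelSplit`: `ND.ToricStage`, `ND.ModelStep`) BY NAME:
`modelStep (n) (k) [Field k] [IsAlgClosed k] (g) (hg : LocalND g) : ModelStep n k g`.  WIDTH, `--supports stmt-ResolutionOfSingularities-20148`, no claim,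
counted 0 (res-L1-w45b-stub-4 g11).  AI-produced kernel work weaker than expert review; no statement of [Hironaka2017] is used; EL♮(3) is NOT proved here.

PROOF.  At a toric stage `(Φ, F, φ, E, T)`, for a `Bad` face `τ ⊆ σ ∈ Φ` with a non-frame ray, fresh for the cones not containing it: legality `hE1`
(`support_stratum_subset_of_charts`, from the (TS1) charts and `Bad`) and `hT` (`not_subset_support_stratum`) are res-L1-w45b-iso-w1's frame helpers
(✓ p643682 `…NatNDModelStepFrame`); for ANY blow-up `υ` of the stratum the new stage is toric: (TS0) `isSmoothCone_of_mem_star`; (TS1) `modelStep_chart`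
(✓ p645939 `…NatNDModelStepChart`, with `τ` having two distinct rays by `exists_ne_of_bad`); (TS2) `isIso_comp_morphismRestrict_compl_affOrigin`; (TS3)
`closure_preimage_diff_inter_compl_eq`; (TS4) `isClosed_closure`; (TS5) `support_stepAlong_subset_preimage` (the stratum lies over the origin by
`support_stratum_subset_preimage`).  `[IsAlgClosed k]` is carried by the spec's signature, not used.
-/

set_option linter.dupNamespace false

noncomputable section

open CategoryTheory AlgebraicGeometry TopologicalSpace MvPolynomial
open Literature.AlgebraicGeometry.Resolution
open AlgebraicGeometry.Scheme.IdealSheafData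

namespace Summit.ResolutionOfSingularities.ResolutionOfSingularities.Cruxes.EquisingularLiftNat.Sections.ND

variable (n : ℕ) (k : Type) [Field k]

/-- **(B4α1s) `modelStep`**: at a toric stage, a `Bad` face with a non-frame ray, fresh for the cones not containing it, is an E1-legal centre, and ANY
blow-up of its stratum is again a toric stage at the starred fan with the stepped boundary and the strict transform.  Legality `hE1`/`hT`, (TS0), (TS2),
(TS3), (TS5) are res-L1-w45b-iso-w1's frame helpers (✓ p643682 `…NatNDModelStepFrame`); (TS1) is `modelStep_chart` (`…NatNDModelStepChart`); (TS4) is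
`isClosed_closure`. [OURS · L1 W4.5b · ND-K5 (B4α1s)] -/
theorem modelStep [IsAlgClosed k] (g : MvPolynomial (Fin n) k) (hg : LocalND g) : ModelStep n k g := by
  intro Φ F φ E T hTS σ hσ τ hτσ hbad hτe hfresh
  obtain ⟨h0, h1, h2, h3, h4, h5⟩ := hTS
  have hg0 : g ≠ 0 := ne_zero_of_isLocallyND hg.2
  have hE1 : ((stratum E τ).support : Set F) ⊆ T :=
    support_stratum_subset_of_charts g Φ φ E T (toricChartHom n k) h1 hbad
  have hT : ¬ T ⊆ ((stratum E τ).support : Set F) :=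
    not_subset_support_stratum g hg h0 φ E T h2 h3 h5 hσ hτσ hτe
  refine ⟨⟨hE1, hT⟩, fun F' υ hυ => ?_⟩
  have hτ2 : ∃ ρ₁ ∈ τ, ∃ ρ₂ ∈ τ, ρ₁ ≠ ρ₂ := exists_ne_of_bad (table_nonempty hg0) hbad
  have hC : ((stratum E τ).support : Set F) ⊆ φ ⁻¹' {affOrigin n k} := support_stratum_subset_preimage φ E hτe h5
  refine ⟨isSmoothCone_of_mem_star h0 τ, fun x' => modelStep_chart g hg0 h0 φ E T h1 hτ2 hfresh υ hυ x', ?_, ?_, isClosed_closure, ?_⟩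
  · exact isIso_comp_morphismRestrict_compl_affOrigin φ h2 (stratum E τ) hC υ hυ
  · exact closure_preimage_diff_inter_compl_eq φ g T h4 h3 (stratum E τ) hC υ
  · exact support_stepAlong_subset_preimage φ E τ hτe h5 υ

end Summit.ResolutionOfSingularities.ResolutionOfSingularities.Cruxes.EquisingularLiftNat.Sections.ND

end
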